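import Literature.Analysis.Complex.WindingCertificate
import HarnessLib

/-!
# Zero COUNTS from the argument principle on a rectangle: exact multiplicities from `∮ f'/f`

Trunk T-ANA (`Literature/Analysis/Complex`). Companion of `WindingCertificate.lean`
(`Literature.Analysis.Complex.rectBoundaryIntegral_logDeriv_eq_turns`: with quarter-plane labels on the pieces of
`∂K`, `K = [a,b] × [c,d]`, one has `∮_{∂K} f'/f = T · (π/2) i`; `Literature.Analysis.Complex.no_zero_of_winding_certificate`:
`T = 0 ⇒` no zero) and of the argument principle `Literature.Analysis.Complex.integral_boundary_rect_logDeriv`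
(`∮_{∂K} f'/f = 2πi · Σ_{ρ ∈ K°, f ρ = 0} m(ρ)`). Two additions, all proved (the anchored-piece form of the
certificate, matching validated Taylor-model sweeps, is in `WindingCertificateAnchored.lean`):

**§1 Counting from the value of the boundary integral.** If `f` is analytic at every point of the closed
rectangle and non-zero on `∂K`, and `∮_{∂K} f'/f = v`, then `v = 2πi · n` with `n = Σ m(ρ) ∈ ℕ`, the zeros
of the open rectangle counted with their analytic orders
(`Literature.Analysis.Complex.exists_count_of_rectBoundaryIntegral_eq`, `Literature.Analysis.Complex.exists_count_im_eq`);
hence `v.im < 2π ⇒` zero-free (`Literature.Analysis.Complex.no_zero_of_rectBoundaryIntegral_im_lt`), `v ≠ 0 ⇒` a zero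
exists (`Literature.Analysis.Complex.exists_zero_of_rectBoundaryIntegral_ne_zero`), and — the form a spectral
certificate needs — **`v.im < 4π` together with ONE KNOWN zero `ρ₀ ∈ K°` forces `ρ₀` to be the only zero in
`K°` and `analyticOrderAt f ρ₀ = 1`** (`Literature.Analysis.Complex.eq_of_rectBoundaryIntegral_im_lt`,
`Literature.Analysis.Complex.analyticOrderAt_eq_one_of_rectBoundaryIntegral_im_lt`; then `deriv f ρ₀ ≠ 0` by
`Literature.Analysis.OperatorTheory.deriv_ne_zero_of_analyticOrderAt_eq_one`, and for an Evans function
`Literature.Analysis.OperatorTheory.pencil_rankOne_algebraically_simple` — not imported here).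

**§2 The quarter-turn certificate counts exactly.** `4 · Σ m(ρ) = T` for `T = certTurns …`
(`Literature.Analysis.Complex.four_mul_count_eq_certTurns`, so `0 ≤ T`, `4 ∣ T`); `T < 4 ⇒` zero-free
(`Literature.Analysis.Complex.no_zero_of_certTurns_lt_four`); `T < 8` with a known interior zero `ρ₀ ⇒` `ρ₀` is the
only zero and it is simple (`Literature.Analysis.Complex.eq_of_winding_certificate`,
`Literature.Analysis.Complex.analyticOrderAt_eq_one_of_winding_certificate`). (`T ≠ 0 ⇒` a zero exists is
`Literature.NumberTheory.LFunctions.Spira1966.exists_zero_of_winding_certificate`, not restated.)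

## References

* J. B. Conway, *Functions of One Complex Variable I*, 2nd ed., GTM 11, Springer 1978, Ch. V Thm. 3.4
  (argument principle). [Conway1978]
* P. Henrici, *Applied and Computational Complex Analysis*, Vol. 1, Wiley 1974, §4.6 (principle of the
  argument along polygons). [folklore]
-/
noncomputable section

open Complex Set MeasureTheory intervalIntegral
open scoped Real

namespace Literature.Analysis.Complex

variable {a b c d : ℝ}

/-! ### §1 From the value of `∮ f'/f` to the zero count -/

/-- **The boundary integral is `2πi` times a natural number, the number of zeros with multiplicity.**
Let `f` be analytic at every point of `[a,b] × [c,d]` (`a < b`, `c < d`) and non-zero on the four edges.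
Then there are a finite set `s` — exactly the zeros of `f` in the open rectangle — and positive integers
`m ρ = analyticOrderAt f ρ` (`ρ ∈ s`) with `∮_{∂K} f'/f = 2πi · Σ_{ρ ∈ s} m ρ`
(four-term convention of `Literature.Analysis.Complex.rectBoundaryIntegral`). [cite: Conway1978, Ch. V Thm. 3.4] -/
theorem exists_count_of_rectBoundaryIntegral_eq {f : ℂ → ℂ} (hab : a < b) (hcd : c < d)
    (hf : AnalyticOnNhd ℂ f (Icc a b ×ℂ Icc c d))
    (h_bot : ∀ x ∈ Icc a b, f (x + c * I) ≠ 0) (h_top : ∀ x ∈ Icc a b, f (x + d * I) ≠ 0)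
    (h_left : ∀ y ∈ Icc c d, f (a + y * I) ≠ 0) (h_right : ∀ y ∈ Icc c d, f (b + y * I) ≠ 0) :
    ∃ (s : Finset ℂ) (m : ℂ → ℕ), (∀ z, z ∈ s ↔ f z = 0 ∧ z ∈ Ioo a b ×ℂ Ioo c d) ∧
      (∀ ρ ∈ s, 1 ≤ m ρ ∧ analyticOrderAt f ρ = m ρ) ∧
      rectBoundaryIntegral (fun z ↦ deriv f z / f z) a b c d =
        2 * π * I * ((∑ ρ ∈ s, m ρ : ℕ) : ℂ) := by
  have hAP := integral_boundary_rect_logDeriv hab hcd hf h_bot h_top h_left h_right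
  have hcorner : ((a : ℂ) + c * I) ∈ Icc a b ×ℂ Icc c d :=
    ⟨by simpa using hab.le, by simpa using hcd.le⟩
  have hw : f (a + c * I) ≠ 0 := h_bot a ⟨le_rfl, hab.le⟩
  have hfin := finite_zeros_reProdIm hab.le hcd.le hf hcorner hw
  refine ⟨hfin.toFinset, fun ρ ↦ (analyticOrderAt f ρ).toNat, fun z ↦ by simp, ?_, ?_⟩
  · intro ρ hρ
    rw [Set.Finite.mem_toFinset] at hρ
    obtain ⟨h0, hρK⟩ := hρ
    have hρK' : ρ ∈ Icc a b ×ℂ Icc c d := ⟨Ioo_subset_Icc_self hρK.1, Ioo_subset_Icc_self hρK.2⟩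
    have han : AnalyticAt ℂ f ρ := hf ρ hρK'
    have hne := analyticOrderAt_ne_top_of_reProdIm hab.le hcd.le hf hcorner hw hρK'
    have heq : analyticOrderAt f ρ = ((analyticOrderAt f ρ).toNat : ℕ∞) :=
      (ENat.coe_toNat_eq_self.mpr hne).symm
    refine ⟨?_, heq⟩
    show 1 ≤ (analyticOrderAt f ρ).toNat
    refine Nat.one_le_iff_ne_zero.mpr fun h0' ↦ ?_
    rw [h0'] at heq
    exact (han.analyticOrderAt_eq_zero.mp (by exact_mod_cast heq)) h0
  · rw [rectBoundaryIntegral_def, hAP, finsum_mem_eq_finite_toFinset_sum _ hfin]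
    congr 1
    push_cast
    refine Finset.sum_congr rfl fun ρ hρ ↦ ?_
    rw [Set.Finite.mem_toFinset] at hρ
    obtain ⟨_, hρK⟩ := hρ
    have hρK' : ρ ∈ Icc a b ×ℂ Icc c d := ⟨Ioo_subset_Icc_self hρK.1, Ioo_subset_Icc_self hρK.2⟩
    have han : AnalyticAt ℂ f ρ := hf ρ hρK'
    have hne := analyticOrderAt_ne_top_of_reProdIm hab.le hcd.le hf hcorner hw hρK'
    obtain ⟨n, hn⟩ := ENat.ne_top_iff_exists.mp hne
    rw [han.meromorphicOrderAt_eq, ← hn]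
    simp [ENat.toNat_coe]

/-- The real part of `∮_{∂K} f'/f` vanishes and its imaginary part is `2π` times the number of zeros.
Packaged consequence of `exists_count_of_rectBoundaryIntegral_eq` for a given value `v` of the boundary
integral: `v.re = 0` and `v.im = 2π n`, `n` the count. [cite: Conway1978, Ch. V Thm. 3.4] -/
theorem exists_count_im_eq {f : ℂ → ℂ} (hab : a < b) (hcd : c < d)
    (hf : AnalyticOnNhd ℂ f (Icc a b ×ℂ Icc c d))
    (h_bot : ∀ x ∈ Icc a b, f (x + c * I) ≠ 0) (h_top : ∀ x ∈ Icc a b, f (x + d * I) ≠ 0)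
    (h_left : ∀ y ∈ Icc c d, f (a + y * I) ≠ 0) (h_right : ∀ y ∈ Icc c d, f (b + y * I) ≠ 0)
    {v : ℂ} (hv : rectBoundaryIntegral (fun z ↦ deriv f z / f z) a b c d = v) :
    ∃ (s : Finset ℂ) (m : ℂ → ℕ), (∀ z, z ∈ s ↔ f z = 0 ∧ z ∈ Ioo a b ×ℂ Ioo c d) ∧
      (∀ ρ ∈ s, 1 ≤ m ρ ∧ analyticOrderAt f ρ = m ρ) ∧
      v.re = 0 ∧ v.im = 2 * π * ((∑ ρ ∈ s, m ρ : ℕ) : ℝ) := by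
  obtain ⟨s, m, hs, hm, hint⟩ :=
    exists_count_of_rectBoundaryIntegral_eq hab hcd hf h_bot h_top h_left h_right
  refine ⟨s, m, hs, hm, ?_, ?_⟩
  · rw [← hv, hint]
    simp
  · rw [← hv, hint]
    simp

/-- **Zero-freeness from an upper bound on the change of argument.** If `∮_{∂K} f'/f = v` with
`Im v < 2π`, then `f` has no zero in the open rectangle. [cite: Conway1978, Ch. V Thm. 3.4] -/
theorem no_zero_of_rectBoundaryIntegral_im_lt {f : ℂ → ℂ} (hab : a < b) (hcd : c < d)
    (hf : AnalyticOnNhd ℂ f (Icc a b ×ℂ Icc c d))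
    (h_bot : ∀ x ∈ Icc a b, f (x + c * I) ≠ 0) (h_top : ∀ x ∈ Icc a b, f (x + d * I) ≠ 0)
    (h_left : ∀ y ∈ Icc c d, f (a + y * I) ≠ 0) (h_right : ∀ y ∈ Icc c d, f (b + y * I) ≠ 0)
    {v : ℂ} (hv : rectBoundaryIntegral (fun z ↦ deriv f z / f z) a b c d = v)
    (him : v.im < 2 * π) : ∀ z ∈ Ioo a b ×ℂ Ioo c d, f z ≠ 0 := by
  obtain ⟨s, m, hs, hm, -, hvim⟩ := exists_count_im_eq hab hcd hf h_bot h_top h_left h_right hv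
  intro z hz h0
  have hzs : z ∈ s := (hs z).2 ⟨h0, hz⟩
  have h1 : 1 ≤ ∑ ρ ∈ s, m ρ :=
    (hm z hzs).1.trans (Finset.single_le_sum (fun ρ _ ↦ Nat.zero_le (m ρ)) hzs)
  have h2 : (1 : ℝ) ≤ ((∑ ρ ∈ s, m ρ : ℕ) : ℝ) := by exact_mod_cast h1
  nlinarith [Real.pi_pos]

/-- **Existence of a zero from a non-zero boundary integral.** If `∮_{∂K} f'/f = v ≠ 0`, then `f` has a
zero in the open rectangle. [cite: Conway1978, Ch. V Thm. 3.4] -/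
theorem exists_zero_of_rectBoundaryIntegral_ne_zero {f : ℂ → ℂ} (hab : a < b) (hcd : c < d)
    (hf : AnalyticOnNhd ℂ f (Icc a b ×ℂ Icc c d))
    (h_bot : ∀ x ∈ Icc a b, f (x + c * I) ≠ 0) (h_top : ∀ x ∈ Icc a b, f (x + d * I) ≠ 0)
    (h_left : ∀ y ∈ Icc c d, f (a + y * I) ≠ 0) (h_right : ∀ y ∈ Icc c d, f (b + y * I) ≠ 0)
    {v : ℂ} (hv : rectBoundaryIntegral (fun z ↦ deriv f z / f z) a b c d = v) (hv0 : v ≠ 0) :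
    ∃ z ∈ Ioo a b ×ℂ Ioo c d, f z = 0 := by
  obtain ⟨s, m, hs, -, hvre, hvim⟩ := exists_count_im_eq hab hcd hf h_bot h_top h_left h_right hv
  by_contra hne
  push Not at hne
  have hs0 : s = ∅ := by
    rw [Finset.eq_empty_iff_forall_notMem]
    intro z hz
    exact hne z ((hs z).1 hz).2 ((hs z).1 hz).1
  rw [hs0, Finset.sum_empty] at hvim
  simp only [CharP.cast_eq_zero, mul_zero] at hvim
  exact hv0 (Complex.ext (by simpa using hvre) (by simpa using hvim))

/-- **Exactly one zero, and it is simple.** If `∮_{∂K} f'/f = v` with `Im v < 4π` and `f` has a zero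
`ρ₀` in the open rectangle, then `ρ₀` is the ONLY zero of `f` in the open rectangle. (Each zero
contributes at least `2π` to `Im v = 2π Σ m`.) [cite: Conway1978, Ch. V Thm. 3.4] -/
theorem eq_of_rectBoundaryIntegral_im_lt {f : ℂ → ℂ} (hab : a < b) (hcd : c < d)
    (hf : AnalyticOnNhd ℂ f (Icc a b ×ℂ Icc c d))
    (h_bot : ∀ x ∈ Icc a b, f (x + c * I) ≠ 0) (h_top : ∀ x ∈ Icc a b, f (x + d * I) ≠ 0)
    (h_left : ∀ y ∈ Icc c d, f (a + y * I) ≠ 0) (h_right : ∀ y ∈ Icc c d, f (b + y * I) ≠ 0)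
    {v : ℂ} (hv : rectBoundaryIntegral (fun z ↦ deriv f z / f z) a b c d = v)
    (him : v.im < 4 * π) {ρ₀ : ℂ} (hρ₀ : ρ₀ ∈ Ioo a b ×ℂ Ioo c d) (hρ₀0 : f ρ₀ = 0) :
    ∀ z ∈ Ioo a b ×ℂ Ioo c d, f z = 0 → z = ρ₀ := by
  obtain ⟨s, m, hs, hm, -, hvim⟩ := exists_count_im_eq hab hcd hf h_bot h_top h_left h_right hv
  have hρs : ρ₀ ∈ s := (hs ρ₀).2 ⟨hρ₀0, hρ₀⟩
  -- the count is `< 2`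
  have hlt : ∑ ρ ∈ s, m ρ < 2 := by
    by_contra hge
    push Not at hge
    have h2 : (2 : ℝ) ≤ ((∑ ρ ∈ s, m ρ : ℕ) : ℝ) := by exact_mod_cast hge
    nlinarith [Real.pi_pos]
  intro z hz h0
  have hzs : z ∈ s := (hs z).2 ⟨h0, hz⟩
  by_contra hne
  have hsub : ({z, ρ₀} : Finset ℂ) ⊆ s := by
    intro w hw
    simp only [Finset.mem_insert, Finset.mem_singleton] at hw
    rcases hw with rfl | rfl
    · exact hzs
    · exact hρs
  have h2 : 2 ≤ ∑ ρ ∈ s, m ρ :=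
    calc 2 = ∑ ρ ∈ ({z, ρ₀} : Finset ℂ), 1 := by rw [Finset.sum_const, Finset.card_pair hne]; simp
      _ ≤ ∑ ρ ∈ ({z, ρ₀} : Finset ℂ), m ρ := Finset.sum_le_sum fun ρ hρ ↦ (hm ρ (hsub hρ)).1
      _ ≤ ∑ ρ ∈ s, m ρ := Finset.sum_le_sum_of_subset_of_nonneg hsub fun _ _ _ ↦ Nat.zero_le _
  omega

/-- **Exactly one zero, and it is simple** (order statement). Under the hypotheses of
`eq_of_rectBoundaryIntegral_im_lt`, the known zero `ρ₀` has `analyticOrderAt f ρ₀ = 1` (hence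
`deriv f ρ₀ ≠ 0`, `Literature.Analysis.OperatorTheory.deriv_ne_zero_of_analyticOrderAt_eq_one`, not imported here).
[cite: Conway1978, Ch. V Thm. 3.4] -/
theorem analyticOrderAt_eq_one_of_rectBoundaryIntegral_im_lt {f : ℂ → ℂ} (hab : a < b) (hcd : c < d)
    (hf : AnalyticOnNhd ℂ f (Icc a b ×ℂ Icc c d))
    (h_bot : ∀ x ∈ Icc a b, f (x + c * I) ≠ 0) (h_top : ∀ x ∈ Icc a b, f (x + d * I) ≠ 0)
    (h_left : ∀ y ∈ Icc c d, f (a + y * I) ≠ 0) (h_right : ∀ y ∈ Icc c d, f (b + y * I) ≠ 0)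
    {v : ℂ} (hv : rectBoundaryIntegral (fun z ↦ deriv f z / f z) a b c d = v)
    (him : v.im < 4 * π) {ρ₀ : ℂ} (hρ₀ : ρ₀ ∈ Ioo a b ×ℂ Ioo c d) (hρ₀0 : f ρ₀ = 0) :
    analyticOrderAt f ρ₀ = 1 := by
  obtain ⟨s, m, hs, hm, -, hvim⟩ := exists_count_im_eq hab hcd hf h_bot h_top h_left h_right hv
  have hρs : ρ₀ ∈ s := (hs ρ₀).2 ⟨hρ₀0, hρ₀⟩
  have hlt : ∑ ρ ∈ s, m ρ < 2 := by
    by_contra hge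
    push Not at hge
    have h2 : (2 : ℝ) ≤ ((∑ ρ ∈ s, m ρ : ℕ) : ℝ) := by exact_mod_cast hge
    nlinarith [Real.pi_pos]
  have hle : m ρ₀ ≤ ∑ ρ ∈ s, m ρ := Finset.single_le_sum (fun ρ _ ↦ Nat.zero_le (m ρ)) hρs
  have hm1 : m ρ₀ = 1 := by have := (hm ρ₀ hρs).1; omega
  rw [(hm ρ₀ hρs).2, hm1]; rfl

/-! ### §2 The quarter-turn certificate of `WindingCertificate.lean` counts exactly -/

/-- **`4 · #zeros = T`.** Under the hypotheses of `Literature.Analysis.Complex.rectBoundaryIntegral_logDeriv_eq_turns`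
with `a < b`, `c < d`: the zeros of `f` in the open rectangle form a finite set `s` with multiplicities
`m ρ = analyticOrderAt f ρ ≥ 1` and `4 · Σ_{ρ ∈ s} m ρ = certTurns …` (so `T ≥ 0` and `4 ∣ T`).
[cite: Henrici1974, §4.10 Thm. 4.10a with §4.6 Appendix eq. (4.6-14)] -/
theorem four_mul_count_eq_certTurns {f : ℂ → ℂ} (hab : a < b) (hcd : c < d)
    (hf : AnalyticOnNhd ℂ f (Icc a b ×ℂ Icc c d))
    {xB : ℝ} {dB : Fin 4} {LB : List (ℝ × Fin 4)} (hB : HPieces f c a ((xB, dB) :: LB))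
    (hBe : piecesLast xB LB = b)
    {yR : ℝ} {dR : Fin 4} {LR : List (ℝ × Fin 4)} (hR : VPieces f b c ((yR, dR) :: LR))
    (hRe : piecesLast yR LR = d)
    {xT : ℝ} {dT : Fin 4} {LT : List (ℝ × Fin 4)} (hT : HPieces f d a ((xT, dT) :: LT))
    (hTe : piecesLast xT LT = b)
    {yL : ℝ} {dL : Fin 4} {LL : List (ℝ × Fin 4)} (hL : VPieces f a c ((yL, dL) :: LL))
    (hLe : piecesLast yL LL = d) :
    ∃ (s : Finset ℂ) (m : ℂ → ℕ), (∀ z, z ∈ s ↔ f z = 0 ∧ z ∈ Ioo a b ×ℂ Ioo c d) ∧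
      (∀ ρ ∈ s, 1 ≤ m ρ ∧ analyticOrderAt f ρ = m ρ) ∧
      4 * ((∑ ρ ∈ s, m ρ : ℕ) : ℤ) = certTurns dB LB dR LR dT LT dL LL := by
  have h_bot : ∀ x ∈ Icc a b, f (x + c * I) ≠ 0 := fun x hx ↦
    hB.ne_zero x (by simpa [hBe] using hx) (by simp)
  have h_top : ∀ x ∈ Icc a b, f (x + d * I) ≠ 0 := fun x hx ↦
    hT.ne_zero x (by simpa [hTe] using hx) (by simp)
  have h_left : ∀ y ∈ Icc c d, f (a + y * I) ≠ 0 := fun y hy ↦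
    hL.ne_zero y (by simpa [hLe] using hy) (by simp)
  have h_right : ∀ y ∈ Icc c d, f (b + y * I) ≠ 0 := fun y hy ↦
    hR.ne_zero y (by simpa [hRe] using hy) (by simp)
  have hT' := rectBoundaryIntegral_logDeriv_eq_turns hf hB hBe hR hRe hT hTe hL hLe
  obtain ⟨s, m, hs, hm, -, hvim⟩ :=
    exists_count_im_eq hab hcd hf h_bot h_top h_left h_right hT'
  refine ⟨s, m, hs, hm, ?_⟩
  have him : ((certTurns dB LB dR LR dT LT dL LL : ℂ) * (π / 2) * I).im =
      (certTurns dB LB dR LR dT LT dL LL : ℝ) * (π / 2) := by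
    simp [mul_assoc]
  rw [him] at hvim
  have h4 : (4 : ℝ) * ((∑ ρ ∈ s, m ρ : ℕ) : ℝ) = (certTurns dB LB dR LR dT LT dL LL : ℝ) := by
    nlinarith [Real.pi_pos]
  exact_mod_cast h4

/-- **Zero-freeness for `T < 4`** (in particular `T = 0`, `Literature.Analysis.Complex.no_zero_of_winding_certificate`).
[cite: Henrici1974, §4.10 Thm. 4.10a with §4.6 Appendix eq. (4.6-14)] -/
theorem no_zero_of_certTurns_lt_four {f : ℂ → ℂ} (hab : a < b) (hcd : c < d)
    (hf : AnalyticOnNhd ℂ f (Icc a b ×ℂ Icc c d))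
    {xB : ℝ} {dB : Fin 4} {LB : List (ℝ × Fin 4)} (hB : HPieces f c a ((xB, dB) :: LB))
    (hBe : piecesLast xB LB = b)
    {yR : ℝ} {dR : Fin 4} {LR : List (ℝ × Fin 4)} (hR : VPieces f b c ((yR, dR) :: LR))
    (hRe : piecesLast yR LR = d)
    {xT : ℝ} {dT : Fin 4} {LT : List (ℝ × Fin 4)} (hT : HPieces f d a ((xT, dT) :: LT))
    (hTe : piecesLast xT LT = b)
    {yL : ℝ} {dL : Fin 4} {LL : List (ℝ × Fin 4)} (hL : VPieces f a c ((yL, dL) :: LL))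
    (hLe : piecesLast yL LL = d)
    (hturns : certTurns dB LB dR LR dT LT dL LL < 4) :
    ∀ z ∈ Ioo a b ×ℂ Ioo c d, f z ≠ 0 := by
  obtain ⟨s, m, hs, hm, h4⟩ :=
    four_mul_count_eq_certTurns hab hcd hf hB hBe hR hRe hT hTe hL hLe
  intro z hz h0
  have hzs : z ∈ s := (hs z).2 ⟨h0, hz⟩
  have h1 : 1 ≤ ∑ ρ ∈ s, m ρ :=
    (hm z hzs).1.trans (Finset.single_le_sum (fun ρ _ ↦ Nat.zero_le (m ρ)) hzs)
  omega

/-- **`T < 8` with a known zero: it is the only one.** Under the certificate hypotheses with total turn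
count `T < 8` (so `T = 4`), a zero `ρ₀` of `f` in the open rectangle is its only zero there.
[cite: Henrici1974, §4.10 Thm. 4.10a with §4.6 Appendix eq. (4.6-14)] -/
theorem eq_of_winding_certificate {f : ℂ → ℂ} (hab : a < b) (hcd : c < d)
    (hf : AnalyticOnNhd ℂ f (Icc a b ×ℂ Icc c d))
    {xB : ℝ} {dB : Fin 4} {LB : List (ℝ × Fin 4)} (hB : HPieces f c a ((xB, dB) :: LB))
    (hBe : piecesLast xB LB = b)
    {yR : ℝ} {dR : Fin 4} {LR : List (ℝ × Fin 4)} (hR : VPieces f b c ((yR, dR) :: LR))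
    (hRe : piecesLast yR LR = d)
    {xT : ℝ} {dT : Fin 4} {LT : List (ℝ × Fin 4)} (hT : HPieces f d a ((xT, dT) :: LT))
    (hTe : piecesLast xT LT = b)
    {yL : ℝ} {dL : Fin 4} {LL : List (ℝ × Fin 4)} (hL : VPieces f a c ((yL, dL) :: LL))
    (hLe : piecesLast yL LL = d)
    (hturns : certTurns dB LB dR LR dT LT dL LL < 8) {ρ₀ : ℂ} (hρ₀ : ρ₀ ∈ Ioo a b ×ℂ Ioo c d)
    (hρ₀0 : f ρ₀ = 0) :
    (∀ z ∈ Ioo a b ×ℂ Ioo c d, f z = 0 → z = ρ₀) := by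
  obtain ⟨s, m, hs, hm, h4⟩ :=
    four_mul_count_eq_certTurns hab hcd hf hB hBe hR hRe hT hTe hL hLe
  have hρs : ρ₀ ∈ s := (hs ρ₀).2 ⟨hρ₀0, hρ₀⟩
  have hlt : ∑ ρ ∈ s, m ρ < 2 := by omega
  intro z hz h0
  have hzs : z ∈ s := (hs z).2 ⟨h0, hz⟩
  by_contra hne
  have hsub : ({z, ρ₀} : Finset ℂ) ⊆ s := by
    intro w hw
    simp only [Finset.mem_insert, Finset.mem_singleton] at hw
    rcases hw with rfl | rfl
    · exact hzs
    · exact hρs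
  have h2 : 2 ≤ ∑ ρ ∈ s, m ρ :=
    calc 2 = ∑ ρ ∈ ({z, ρ₀} : Finset ℂ), 1 := by rw [Finset.sum_const, Finset.card_pair hne]; simp
      _ ≤ ∑ ρ ∈ ({z, ρ₀} : Finset ℂ), m ρ := Finset.sum_le_sum fun ρ hρ ↦ (hm ρ (hsub hρ)).1
      _ ≤ ∑ ρ ∈ s, m ρ := Finset.sum_le_sum_of_subset_of_nonneg hsub fun _ _ _ ↦ Nat.zero_le _
  omega

/-- **`T < 8` with a known zero: it is simple.** Under the hypotheses of `eq_of_winding_certificate`,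
`analyticOrderAt f ρ₀ = 1`. [cite: Henrici1974, §4.10 Thm. 4.10a with §4.6 Appendix eq. (4.6-14)] -/
theorem analyticOrderAt_eq_one_of_winding_certificate {f : ℂ → ℂ} (hab : a < b) (hcd : c < d)
    (hf : AnalyticOnNhd ℂ f (Icc a b ×ℂ Icc c d))
    {xB : ℝ} {dB : Fin 4} {LB : List (ℝ × Fin 4)} (hB : HPieces f c a ((xB, dB) :: LB))
    (hBe : piecesLast xB LB = b)
    {yR : ℝ} {dR : Fin 4} {LR : List (ℝ × Fin 4)} (hR : VPieces f b c ((yR, dR) :: LR))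
    (hRe : piecesLast yR LR = d)
    {xT : ℝ} {dT : Fin 4} {LT : List (ℝ × Fin 4)} (hT : HPieces f d a ((xT, dT) :: LT))
    (hTe : piecesLast xT LT = b)
    {yL : ℝ} {dL : Fin 4} {LL : List (ℝ × Fin 4)} (hL : VPieces f a c ((yL, dL) :: LL))
    (hLe : piecesLast yL LL = d)
    (hturns : certTurns dB LB dR LR dT LT dL LL < 8) {ρ₀ : ℂ} (hρ₀ : ρ₀ ∈ Ioo a b ×ℂ Ioo c d)
    (hρ₀0 : f ρ₀ = 0) :
    analyticOrderAt f ρ₀ = 1 := by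
  obtain ⟨s, m, hs, hm, h4⟩ :=
    four_mul_count_eq_certTurns hab hcd hf hB hBe hR hRe hT hTe hL hLe
  have hρs : ρ₀ ∈ s := (hs ρ₀).2 ⟨hρ₀0, hρ₀⟩
  have hlt : ∑ ρ ∈ s, m ρ < 2 := by omega
  have hle : m ρ₀ ≤ ∑ ρ ∈ s, m ρ := Finset.single_le_sum (fun ρ _ ↦ Nat.zero_le (m ρ)) hρs
  have hm1 : m ρ₀ = 1 := by have := (hm ρ₀ hρs).1; omega
  rw [(hm ρ₀ hρs).2, hm1]; rfl

end Literature.Analysis.Complex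

end
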